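import Literature.NumberTheory.EllipticCurves.NewformPadicIntegralModel
import Literature.NumberTheory.EllipticCurves.CyclotomicPAdicLFunctionWeightK
import HarnessLib

/-!
# X. Wan, *The Iwasawa main conjecture for Hilbert modular forms* (Forum Math. Sigma 3 (2015) e18),
# Thm. 4 (= Thm. 103), RATIONAL part — instance: a good-ordinary higher-weight member of the Hida
# family of an elliptic curve with surjective `ρ̄_{E,p}` (named fact, D-0014), class X11a

HONEST FRAMING (cell `b2b-bsdres`, home `run/shared/lean/b2b/bsd-rank1-residual/`): the cell deletes
COMBINATION-SHAPED residual classes of the rank-`≤ 1` BSD formula from PUBLISHED theorems only and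
types the rest; this is not "finishing BSD". This file vendors ONE printed theorem (rational part
only) as a named fact (`def … : Prop`, nothing asserted, no `_holds`), as an INSTANCE, in the
Greenberg–Selmer vocabulary of `GreenbergSelmerNewform.lean` and the `p`-adic vocabulary of
`NewformPadicIntegralModel.lean` / `CyclotomicPAdicLFunctionWeightK.lean`. It is step [L2] of the
X11a chain (HOME/b2b-bsdres-x11a/X11A-CHAIN.md), audited by the cell's literature seat
(HOME/b2b-bsdres-lit/g14/X11A-AUDIT.md (b)) and re-checked by the reviewer of p204620 ("the
docstring's quotation is accurate … the separate Wan instance can be vendored verbatim as stated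
(integral part … must NOT be vendored in the rational form's generality)").

## Source (publisher PDF, pp. 4–5 = pp. 91–92; pages read by the literature seat)

VERBATIM (Thm. 4, pp. 4–5; = Thm. 103, pp. 91–92): "THEOREM 4. Suppose that `p ≥ 5`. Let
`f ∈ S_κ(M, L)`, `2 | κ ≥ 2` be a `p`-ordinary cuspidal eigenform with trivial character, `p ∤ M`, and
`L ⊂ ℚ̄_p` a finite extension of `ℚ_p`. Suppose that • (irred) and (dist) hold for `ρ_f`. Then, for any
set of primes `Σ`, `char^Σ_{ℚ∞,L}(f) = (L^Σ_f)` in `Λ_{ℚ,𝒪_L} ⊗_{ℤ_p} ℚ_p`. If, furthermore, • there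
is an `𝒪_L`-basis of `T_f` with respect to which the image of `ρ_f` contains `SL₂(ℤ_p)`, and • there
exists a real quadratic extension `F/ℚ` such that … then the equality holds in `Λ_{ℚ,𝒪_L}`." with
(p. 3) "(irred) The residual Galois representation `ρ̄_f` of `f` is irreducible. (dist) For `V = ρ_f`
and each prime `v | p`, the `𝒪_L^×`-valued characters giving the actions of `G_{F,v}` on `V_v^+` and
`V/V_v^+` are distinct modulo the maximal ideal of `𝒪_L`"; p. 4 "Our next result (Theorem 103)
states that the main theorem of [44, Theorem 3.29] is true without the third assumption in [44]"
([44] = Skinner–Urban 2014; the removed assumption is the auxiliary ramified prime `ℓ ‖ M`, p. 91).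
Here `char_{ℚ∞,L}(f)` (`Σ = ∅`) is the characteristic ideal of the `Λ_{𝒪_L}`-dual of Greenberg's
Selmer group `Sel(ℚ_∞, T_f ⊗ L/𝒪_L)` (Skinner–Urban 2014 §3.1.3; = EPW's `Sel(ℚ_∞, A_f)`, §3.1) and
`L_f` the cyclotomic `p`-adic `L`-function of `f` (w.r.t. Skinner–Urban's canonical period). ONLY THE
RATIONAL EQUALITY IS VENDORED.

## The instance, and its faithfulness
`E/ℚ` globally minimal, `5 ≤ p`, `p ‖ N`, `ρ̄_{E,p}` SURJECTIVE; `f := ` the ordinary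
`p`-stabilisation of `g`, where `(g, ι)` is an ordinary member of `H(E[p])` of level `M = N/p`
(`IsOrdinaryMemberOf`: `g ∈ S_k(Γ₀(N/p))` newform, `k > 2`, `k ≡ 2 (mod p−1)`, `|ι a_p(g)|_p = 1`,
`g ≡ f_E`), with ordinary `p`-adic data `𝔇` (unit root `υ`, integral model `ρ` over the integers of
`L := ℚ_p(ι K_g, υ)`, ordinary filtration). Printed hypotheses: `p ≥ 5` ✓; `2 | κ ≥ 2` ✓ (`k − 2`
divisible by the even `p − 1`); trivial character ✓ (`Γ₀`); `p ∤ M` ✓ (hypothesis `¬ p ∣ N/p`, i.e.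
`p ‖ N`); `p`-ordinary ✓; (irred) ✓ — `ρ̄_f ≅ E[p]` is surjective, hence absolutely irreducible; the
proof of Thm. 103 invokes Fujiwara's Thm. 8, whose residual hypotheses (`ρ̄|_{ℚ(ζ_p)}` absolutely
irreducible, the `p = 5` projective exclusion) HOLD for surjective `ρ̄`, `p ≥ 5` (`SL₂(𝔽_p)` perfect)
— audit (b), informational flag `Wan15-Thm103-Fujiwara`; (dist) ✓ — on inertia the two characters
are `ω^{k−1} = ω` and `1`, distinct. Conclusion as typed: for every cyclotomic `(κ, γ)` (`T ↔ γ − 1`,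
`IsCyclotomicVariable`), every TORSION `Λ_𝒪`-dual datum `D` of Greenberg's Selmer group with a
generator `G` of `charIdeal(D)`, and THE cyclotomic `p`-adic `L`-function `L` of `(g, ι, υ)` in any
Shimura normalisation `Dsym` (`IsCycPAdicLFunctionWeightK`; differs from `L_f` by a non-zero constant
— the period ratio): `L = c · u · G` for a non-zero constant `c ∈ ℚ̄_p` and a unit `u ∈ Λ_𝒪^×` —
which is "`char_{ℚ∞,L}(f) = (L_f)` in `Λ_{ℚ,𝒪_L} ⊗ ℚ_p`" (the units of `Λ_𝒪 ⊗ ℚ_p` are `π^ℤ·Λ_𝒪^×`;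
the constant is allowed in `ℚ̄_p^×` ⊇ `L^×`, a harmless weakening). In particular
`λ^alg(g) = normLam G = normLam L = λ^an(g)`. Named fact; nothing asserted.

## Status of the source in print (FRESHNESS, literature seat, read 2026-08-20)

Burungale–Castella–Skinner, *Base change and Iwasawa main conjectures for GL₂*, IMRN 2025
(arXiv:2405.00270), §3.1, Hypothesis 3.1.1 (pp. 9–10): "The results of [Wan15] are conditional on
the following hypothesis. (H1) `ρ̄_g|_{G_{F(ζ_p)}}` is absolutely irreducible, and for `p = 5` the
following case is excluded: the projective image … is isomorphic to `PGL₂(𝔽_p)` and the mod `p`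
cyclotomic character factors through `G_F → Ḡ^{ab} ≃ ℤ/2ℤ` … (H2) There is a minimal modular
lifting of `ρ̄_g|_{G_F}` (cf. [Fuj06, Def. 6.11]). (H3) For any finite place `v` of `F`, if
`ρ̄_g|_{G_{F_v}}` is absolutely irreducible and `ρ̄_g|_{I_v}` is absolutely reducible, then
`q_v ≢ −1 (mod p)`"; Rem. 3.1.2 (iii): "The case excluded by (H1) does not occur for `g`
corresponding to elliptic curves"; p. 10: "(H2) follows as in [Wan, Thm. 103] … and (H3) also
follows by condition (iii) on `F`" — this is the content of the flag `Wan15-Thm103-Fujiwara`, and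
it is why the instance is restricted to `ρ̄_{E,p}` SURJECTIVE, `p ≥ 5`. Rem. 1.1.3 (ii) (p. 2):
"The only prior result towards Conjecture 1.1.1 [the INTEGRAL cyclotomic main conjecture for `E`]
without assuming the hypothesis (mult) is due to Wan [Wan15] … However, it is conditional on a
`p`-integral comparison of certain automorphic periods, which still remains open"; Rem. 3.2.2
(p. 10): "Wan uses the above divisibility in conjunction with base change to remove the condition
(mult) from the result of [SU14] up to tensoring with `ℚ_p` (cf. [Wan15, Thm. 4])". Reading: the
open period comparison qualifies the INTEGRAL refinement of Thm. 4 only (Wan p. 92: "The assumption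
on the canonical periods for base change is used to ensure that the `p`-adic `L`-function of the
base change splits"), which is NOT vendored; the RATIONAL equality typed here is restated as a
result by BCS 2025 themselves (Rem. 3.2.2). Cell flag (informational): `Wan15-BCS25-Rem113ii`
(HOME/CITED-FACTS.md §A row A87; HOME/FRESHNESS.md Gen-16 note).

References: X. Wan, Forum Math. Sigma 3 (2015) e18, doi:10.1017/fms.2015.16, Thm. 4 (pp. 4–5),
Thm. 103 (pp. 91–92), Thm. 8 (p. 7); C. Skinner, E. Urban, Invent. Math. 195 (2014) — cited below by the
AUTHOR-VERSION numbering of the held text (§3.1.3 p. 18, §3.4.4 p. 38, Thm. 1 = Thm. 3.6.4 p. 43;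
journal numbering: Thm. 3.29, as Wan's own "[44, Theorem 3.29]" above); M. Emerton, R. Pollack,
T. Weston, Invent. Math. 163 (2006) §3.1;
A. Burungale, F. Castella, C. Skinner, IMRN 2025 (arXiv:2405.00270) §3.1, Hyp. 3.1.1, Rem. 1.1.3,
Rem. 3.2.2; HOME/b2b-bsdres-lit/g14/X11A-AUDIT.md (b).
-/

noncomputable section

open scoped Classical MatrixGroups ModularForm

open NumberField IsDedekindDomain Field CongruenceSubgroup
open Literature.NumberTheory.GaloisRepresentations
open Literature.NumberTheory.EllipticCurves.ModularForms

namespace Literature.NumberTheory.EllipticCurves.Wan2015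

/-- **X. Wan, Forum Math. Sigma 3 (2015) e18, Thm. 4 (pp. 4–5) = Thm. 103 (pp. 91–92), RATIONAL
part — instance: a good-ordinary weight-`k` member `(g, ι)` of the Hida family `H(E[p])` of an
elliptic curve `E/ℚ` with `p ‖ N`, `p ≥ 5`, `ρ̄_{E,p}` surjective.** Printed statement: "Suppose that
`p ≥ 5`. Let `f ∈ S_κ(M, L)`, `2 | κ ≥ 2` be a `p`-ordinary cuspidal eigenform with trivial
character, `p ∤ M` … Suppose that (irred) and (dist) hold for `ρ_f`. Then, for any set of primes `Σ`,
`char^Σ_{ℚ∞,L}(f) = (L^Σ_f)` in `Λ_{ℚ,𝒪_L} ⊗_{ℤ_p} ℚ_p`." Typed (module docstring for the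
dictionary and the discharge of every printed hypothesis in the instance; `Σ = ∅`): for `W/ℚ`
globally minimal elliptic, `5 ≤ p`, multiplicative reduction at `p`, `ρ̄_{E,p}` surjective,
`p ∤ N/p`, `(g, ι)` with `IsOrdinaryMemberOf W p g ι`, ordinary `p`-adic data `𝔇`, cyclotomic
`(κ, γ)`, every dual datum `D` of Greenberg's `Sel(ℚ_∞, A_g)` with `D.X` `Λ_𝒪`-torsion and
`charIdeal(D) = (G)`, every Shimura period datum `Dsym` and every `L` with
`IsCycPAdicLFunctionWeightK g Dsym p ι 𝔇.υ L`: there are `c ∈ ℚ̄_p`, `c ≠ 0`, and a unit `u` of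
`Λ_𝒪 = 𝒪⟦T⟧` with `L = c · (u · G)` (coefficientwise in `ℚ̄_p`). Flag (informational, audit (b)):
`Wan15-Thm103-Fujiwara`. Named fact; nothing asserted; no `_holds`.
QUANTIFICATION NOTE (literature seat `lit-su` gen 2, 2026-08-20): this `def` lets `L` range over EVERY
interpolant of `IsCycPAdicLFunctionWeightK`, a predicate that does not determine `L` (`L + log(1+T)`
satisfies it too and has unbounded coefficients, for which `L = c · (u · G)` is impossible); the
printed theorem concerns THE `p`-adic `L`-function `L_f ∈ Λ_{ℚ,𝒪_L}` — the BOUNDED interpolant. The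
print-faithful quantification is `thm4_rational_weightK_member_of_bdd` below (one extra binder, the
boundedness clause that `exists_isCycPAdicLFunctionWeightK` delivers together with `L`); importers
should migrate to it; this declaration is kept unchanged for them meanwhile.
**RETIRED-MISSTATED (cell `b2b-bsdres`, registry A87; referee ruling R121.2, 2026-08-20, endorsing
`lit-su` SU2014-TYPING §5/§8; referee-2 R2-62.2 concurring; deprecate-and-add):** as typed, this
`Prop` is FALSE — for the unbounded interpolant `L + log(1+T)` the conclusion `L = c · (u · G)`
(bounded right-hand side) fails — so a theorem carrying it as a hypothesis certifies nothing
(R121.2: "VACUOUS IN `hT2`"); nothing was ever booked from it. SUPERSEDED by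
`thm4_rational_weightK_member_of_bdd` below (registry A145: one more binder, bounded coefficients =
the printed `𝓛_f ∈ Λ_{ℚ,𝒪_L} ⊗ ℚ_p`), whose uniqueness clause is the tree THEOREM
`IsCycPAdicLFunctionWeightK.eq_of_bounded` (`CyclotomicInterpolantUniquenessProofs.lean`, p241451).
Consumers: the `X11a` chain was re-based on the `_of_bdd` facts (`Summits/…/X11a/ChainBounded.lean`,
p241299, confirmed by the `x11a` seat 2026-08-21 as the base of its chain of record, successors
`ChainBoundedLeaves` / `ChainBoundedHeightFree`); the legacy `X11a/Chain*` theorems still binding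
`hT2 : thm4_rational_weightK_member` are vacuous in `hT2` until re-pointed. This `def` is kept
verbatim (statement unchanged) only so that those importers elaborate; do not use it; it is removed
once no module references it.
-- TODO(general form): the printed generality — any p-ordinary eigenform of even weight ≥ 2,
-- trivial character, p ∤ M, under (irred) + (dist) alone, any Σ; and the INTEGRAL equality under
-- the additional SL₂(ℤ_p)-image / real-quadratic / canonical-period hypotheses (not vendored).
[cite: Wan2015, Thm. 4 (pp. 4–5) = Thm. 103 (pp. 91–92)]
[cite: SkinnerUrban2014, §3.1.3 (p. 18) and Thm. 1 (p. 2) = Thm. 3.6.4 (p. 43) (journal numbering: Thm. 3.29)] -/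
def thm4_rational_weightK_member : Prop :=
  ∀ (W : WeierstrassCurve ℚ) [W.IsElliptic] [W.IsGloballyMinimal] (p : ℕ) [Fact p.Prime],
    5 ≤ p → W.HasMultiplicativeReductionAtPrime p → W.HasSurjectiveModNGaloisRep p →
    ∀ [NeZero (W.conductorNorm ℤ / p)], ¬ p ∣ W.conductorNorm ℤ / p →
    ∀ {k : ℤ} (g : CuspForm (Gamma0 (W.conductorNorm ℤ / p)) k)
      (ι : coeffField g →+* PadicAlgCl p), IsOrdinaryMemberOf W p g ι →
    ∀ (𝔇 : OrdinaryPadicData g p ι) (κ : ZpExtension ℚ p) (γ : Field.absoluteGaloisGroup ℚ),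
      κ.IsCyclotomic → κ.IsTopGenerator γ → IsCyclotomicVariable p γ →
    ∀ (D : GreenbergSelmer.DualData (padicCoeffField (memberGenerators g ι 𝔇.υ)) κ γ 𝔇.ρ 𝔇.plus),
      Module.IsTorsion (PowerSeries (padicCoeffIntegers (memberGenerators g ι 𝔇.υ))) D.X →
    ∀ G : PowerSeries (padicCoeffIntegers (memberGenerators g ι 𝔇.υ)),
      D.charIdeal = Ideal.span {G} →
    ∀ (Dsym : PeriodSymbolDatum g) (L : PowerSeries (PadicAlgCl p)),
      IsCycPAdicLFunctionWeightK g Dsym p ι 𝔇.υ L →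
      ∃ (c : PadicAlgCl p) (u : (PowerSeries (padicCoeffIntegers (memberGenerators g ι 𝔇.υ)))ˣ),
        c ≠ 0 ∧
          L = PowerSeries.C c *
            PowerSeries.map (padicCoeffIntegers (memberGenerators g ι 𝔇.υ)).subtype
              ((u : PowerSeries (padicCoeffIntegers (memberGenerators g ι 𝔇.υ))) * G)

/-! ### The print-faithful quantification: THE (bounded) cyclotomic `p`-adic `L`-function
(literature seat `lit-su` gen 2, 2026-08-20; HOME/b2b-bsdres-lit-su/SU2014-TYPING.md §5, §8) -/

/-- **X. Wan, Forum Math. Sigma 3 (2015) e18, Thm. 4 (pp. 4–5) = Thm. 103 (pp. 91–92), RATIONAL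
part — the same instance as `thm4_rational_weightK_member` (a good-ordinary weight-`k` member
`(g, ι)` of the Hida family `H(E[p])`, `p ‖ N`, `p ≥ 5`, `ρ̄_{E,p}` surjective; every printed
hypothesis discharged as in the module docstring), with the analytic side quantified AS PRINTED:
over THE cyclotomic `p`-adic `L`-function of `(g, ι, υ)`, i.e. over the interpolants `L` of
`IsCycPAdicLFunctionWeightK g Dsym p ι υ` whose coefficients are BOUNDED
(`∃ C, ∀ i, ‖[Tⁱ]L‖ ≤ C` — the clause delivered together with `L` by
`exists_isCycPAdicLFunctionWeightK`, Mazur–Tate–Teitelbaum 1986 §I.11: for a unit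
`U_p`-eigenvalue the modular-symbol distribution is a measure, so its Mellin transform lies in
`Λ_𝒪 ⊗ ℚ_p`; Wan's / Skinner–Urban's `L_f ∈ Λ_{ℚ,𝒪_L}`, SU14 §3.4.4).** Why the binder is part of
the statement: the interpolation property alone (constant term and the values at the points
`χ(γ) − 1`, `χ` even primitive of `p`-power order and conductor) does not single out `L` — with `L`
also `L + log(1 + T)` has it (`log(1+T) = ∑_{i ≥ 1} (−1)^{i+1} Tⁱ/i` has constant term `0` and
vanishes at every `ζ − 1`, `ζ ∈ μ_{p^∞}`), and for that unbounded series the conclusion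
`L = c · (u · G)` (bounded right-hand side) is false; among BOUNDED series the interpolant is unique
(a bounded series vanishing at all `ζ − 1` is `0`: the zeros `ζ − 1` of valuation `1/φ(pⁿ)`,
all `n`, have infinite total valuation — Newton polygon; Weierstrass preparation when the
coefficients lie in a finite extension of `ℚ_p`, the tree's `MemIwasawaRat.eq_zero_of_forall_hasSum_zero`
being the `ℚ_p`-coefficient case), hence equal to `L_f` up to the non-zero period constant, and the typed conclusion is the printed
"`char_{ℚ∞,L}(f) = (L_f)` in `Λ_{ℚ,𝒪_L} ⊗_{ℤ_p} ℚ_p`" for the instance. CONCLUSION (unchanged):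
`c ≠ 0` in `ℚ̄_p` and a unit `u` of `Λ_𝒪 = 𝒪⟦T⟧` with `L = c · (u · G)`, `G` any generator of
`charIdeal` of a torsion dual datum `D` of Greenberg's `Sel(ℚ_∞, A_g)`. Named fact; nothing asserted;
no `_holds`. `thm4_rational_weightK_member_of_bdd.of_unrestricted` records that this statement is
implied by (is weaker than) `thm4_rational_weightK_member`. Flags as there (`Wan15-Thm103-Fujiwara`,
`Wan15-BCS25-Rem113ii`).
**RETIRED-SUBSUMED (cell `b2b-bsdres`, registry A145; cell-lead record 2026-08-21 executing referee
rulings R127.3 / R2-67.2, deprecate-and-add endorsed):** level-`N/p` INSTANCE (member `g` of level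
`N/p`); Wan's Thm. 4 is printed for `f ∈ S_κ(M, L)` of ANY level `M` with `p ∤ M` (p. 4) and is
vendored as the level-generic twin `thm4_rational_weightK_member_of_bdd_ofLevel` below, from which
this instance FOLLOWS (`thm4_rational_weightK_member_of_bdd.of_ofLevel`, proved). The `X11a` chain
of record (`Summits/BirchSwinnertonDyer/Rank1Residual/X11a/ChainAnyLevel.lean`,
`X11a.forall_bsdp_of_namedFacts_ofLevel_heightFree`) binds the twin; the `X11a/ChainBounded*` /
`ChainPrimeConductor` theorems binding `hT2 : thm4_rational_weightK_member_of_bdd` are superseded as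
record and are being re-pointed. Kept verbatim (statement unchanged) only so that those importers
elaborate; new consumers bind the `_ofLevel` twin; removed, together with `.of_unrestricted`, once
no module references it.
-- TODO(general form): as for `thm4_rational_weightK_member`.
[cite: Wan2015, Thm. 4 (pp. 4–5) = Thm. 103 (pp. 91–92)]
[cite: SkinnerUrban2014, §3.1.3 (p. 18), §3.4.4 (p. 38) and Thm. 1 (p. 2) = Thm. 3.6.4 (p. 43) (journal numbering: Thm. 3.29)]
[cite: MazurTateTeitelbaum1986Invent, §I.11 and §I.14 (14.3)] -/
def thm4_rational_weightK_member_of_bdd : Prop :=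
  ∀ (W : WeierstrassCurve ℚ) [W.IsElliptic] [W.IsGloballyMinimal] (p : ℕ) [Fact p.Prime],
    5 ≤ p → W.HasMultiplicativeReductionAtPrime p → W.HasSurjectiveModNGaloisRep p →
    ∀ [NeZero (W.conductorNorm ℤ / p)], ¬ p ∣ W.conductorNorm ℤ / p →
    ∀ {k : ℤ} (g : CuspForm (Gamma0 (W.conductorNorm ℤ / p)) k)
      (ι : coeffField g →+* PadicAlgCl p), IsOrdinaryMemberOf W p g ι →
    ∀ (𝔇 : OrdinaryPadicData g p ι) (κ : ZpExtension ℚ p) (γ : Field.absoluteGaloisGroup ℚ),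
      κ.IsCyclotomic → κ.IsTopGenerator γ → IsCyclotomicVariable p γ →
    ∀ (D : GreenbergSelmer.DualData (padicCoeffField (memberGenerators g ι 𝔇.υ)) κ γ 𝔇.ρ 𝔇.plus),
      Module.IsTorsion (PowerSeries (padicCoeffIntegers (memberGenerators g ι 𝔇.υ))) D.X →
    ∀ G : PowerSeries (padicCoeffIntegers (memberGenerators g ι 𝔇.υ)),
      D.charIdeal = Ideal.span {G} →
    ∀ (Dsym : PeriodSymbolDatum g) (L : PowerSeries (PadicAlgCl p)),
      IsCycPAdicLFunctionWeightK g Dsym p ι 𝔇.υ L →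
      (∃ C : ℝ, ∀ i, ‖PowerSeries.coeff i L‖ ≤ C) →
      ∃ (c : PadicAlgCl p) (u : (PowerSeries (padicCoeffIntegers (memberGenerators g ι 𝔇.υ)))ˣ),
        c ≠ 0 ∧
          L = PowerSeries.C c *
            PowerSeries.map (padicCoeffIntegers (memberGenerators g ι 𝔇.υ)).subtype
              ((u : PowerSeries (padicCoeffIntegers (memberGenerators g ι 𝔇.υ))) * G)

/-- The print-faithful (bounded) quantification is WEAKER than the unrestricted
`thm4_rational_weightK_member`: restricting the interpolants `L` to the bounded ones only drops
instances. (So every consumer of the unrestricted fact may switch to the bounded one, feeding it the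
boundedness clause of `exists_isCycPAdicLFunctionWeightK`.)
[cite: Wan2015, Thm. 4 (pp. 4–5) = Thm. 103 (pp. 91–92)] -/
theorem thm4_rational_weightK_member_of_bdd.of_unrestricted (h : thm4_rational_weightK_member) :
    thm4_rational_weightK_member_of_bdd := by
  intro W _ _ p _ hp hmult hsurj _ hpM k g ι hmem 𝔇 κ γ hκ hγ hγ' D htors G hG Dsym L hL _
  exact h W p hp hmult hsurj hpM g ι hmem 𝔇 κ γ hκ hγ hγ' D htors G hG Dsym L hL


/-! ### Level-generic twin (sized ask S-g19-1 of the `x11a` seat; literature seat gen 40, 2026-08-21;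
deprecate-and-add)

Wan's Thm. 4 is PRINTED for "`f ∈ S_κ(M, L)` … a `p`-ordinary cuspidal eigenform with trivial
character, `p ∤ M`" — ANY level `M` prime to `p` (publisher PDF p. 4; = Thm. 103 p. 91). The instance
above binds the member at level EXACTLY `M = N/p` only because the tree's first producer of members
(Hida 1986, registry A77) delivers that level; the modularity-based producer
`exists_isNewform0_dvd_conductorNorm_div_congr_of_multiplicative_of_exists_isNewformOf`
(`HidaFamilyMembersMultiplicativeProofs.lean`) delivers a member of SOME level `M′ ∣ N/p`. The twin
below frees the level (Wan's own binder `p ∤ M`) and is otherwise BYTE-IDENTICAL to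
`thm4_rational_weightK_member_of_bdd`; the latter is the twin at `M := N/p` (`….of_ofLevel`). -/

/-- **X. Wan, Forum Math. Sigma 3 (2015) e18, Thm. 4 (pp. 4–5) = Thm. 103 (pp. 91–92), RATIONAL
part, bounded (print-faithful) interpolant — level-generic twin of
`thm4_rational_weightK_member_of_bdd`: the member `(g, ι)` of `H(E[p])` of ANY level `M` with
`p ∤ M`.** Printed statement: "Suppose that `p ≥ 5`. Let `f ∈ S_κ(M, L)`, `2 | κ ≥ 2` be a
`p`-ordinary cuspidal eigenform with trivial character, `p ∤ M` … Suppose that (irred) and (dist)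
hold for `ρ_f`. Then, for any set of primes `Σ`, `char^Σ_{ℚ∞,L}(f) = (L^Σ_f)` in
`Λ_{ℚ,𝒪_L} ⊗_{ℤ_p} ℚ_p`." Typed (dictionary, bridges and the discharge of every printed hypothesis
exactly as in the module docstring and in `thm4_rational_weightK_member_of_bdd`; `Σ = ∅`): for
`W/ℚ` globally minimal elliptic, `5 ≤ p`, multiplicative reduction at `p`, `ρ̄_{E,p}` surjective
((irred) for `ρ̄_f ≅ E[p]`, and the residual hypotheses of Fujiwara's Thm. 8 — flag
`Wan15-Thm103-Fujiwara`; (dist): `ω` vs `1` on inertia), a level `M` with `p ∤ M` (Wan's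
"`p ∤ M`"), `(g, ι)` with `IsOrdinaryMemberOfLevel W p g ι` (`g ∈ S_k(Γ₀(M))` newform — trivial
character; `k > 2`, `k ≡ 2 (mod p − 1)` — so `2 ∣ κ ≥ 2`; `|ι a_p(g)|_p = 1` — `p`-ordinary),
ordinary `p`-adic data `𝔇`, cyclotomic `(κ, γ)`, every dual datum `D` of Greenberg's `Sel(ℚ_∞, A_g)`
with `D.X` `Λ_𝒪`-torsion and `charIdeal(D) = (G)`, every Shimura period datum `Dsym` and every
BOUNDED `L` with `IsCycPAdicLFunctionWeightK g Dsym p ι 𝔇.υ L` (THE cyclotomic `p`-adic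
`L`-function, unique among bounded interpolants by `IsCycPAdicLFunctionWeightK.eq_of_bounded`):
there are `c ∈ ℚ̄_p`, `c ≠ 0`, and a unit `u` of `Λ_𝒪 = 𝒪⟦T⟧` with `L = c · (u · G)`. ONLY the
member binder block differs from `thm4_rational_weightK_member_of_bdd`. Flags as there
(`Wan15-Thm103-Fujiwara`, `Wan15-BCS25-Rem113ii`, informational). Named fact; nothing asserted;
no `_holds`.
-- TODO(general form): as for `thm4_rational_weightK_member` (any p-ordinary eigenform of even
-- weight ≥ 2 under (irred) + (dist) alone, any Σ; the INTEGRAL equality not vendored).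
[cite: Wan2015, Thm. 4 (pp. 4–5) = Thm. 103 (pp. 91–92)]
[cite: SkinnerUrban2014, §3.1.3 (p. 18), §3.4.4 (p. 38) and Thm. 1 (p. 2) = Thm. 3.6.4 (p. 43) (journal numbering: Thm. 3.29)]
[cite: MazurTateTeitelbaum1986Invent, §I.11 and §I.14 (14.3)]
[cite: EmertonPollackWeston2006, Intro p. 2 (H(ρ̄): members of every tame level) (arXiv:math/0404484 p. 2)] -/
def thm4_rational_weightK_member_of_bdd_ofLevel : Prop :=
  ∀ (W : WeierstrassCurve ℚ) [W.IsElliptic] [W.IsGloballyMinimal] (p : ℕ) [Fact p.Prime],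
    5 ≤ p → W.HasMultiplicativeReductionAtPrime p → W.HasSurjectiveModNGaloisRep p →
    ∀ {M : ℕ} [NeZero M], ¬ p ∣ M →
    ∀ {k : ℤ} (g : CuspForm (Gamma0 M) k)
      (ι : coeffField g →+* PadicAlgCl p), IsOrdinaryMemberOfLevel W p g ι →
    ∀ (𝔇 : OrdinaryPadicData g p ι) (κ : ZpExtension ℚ p) (γ : Field.absoluteGaloisGroup ℚ),
      κ.IsCyclotomic → κ.IsTopGenerator γ → IsCyclotomicVariable p γ →
    ∀ (D : GreenbergSelmer.DualData (padicCoeffField (memberGenerators g ι 𝔇.υ)) κ γ 𝔇.ρ 𝔇.plus),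
      Module.IsTorsion (PowerSeries (padicCoeffIntegers (memberGenerators g ι 𝔇.υ))) D.X →
    ∀ G : PowerSeries (padicCoeffIntegers (memberGenerators g ι 𝔇.υ)),
      D.charIdeal = Ideal.span {G} →
    ∀ (Dsym : PeriodSymbolDatum g) (L : PowerSeries (PadicAlgCl p)),
      IsCycPAdicLFunctionWeightK g Dsym p ι 𝔇.υ L →
      (∃ C : ℝ, ∀ i, ‖PowerSeries.coeff i L‖ ≤ C) →
      ∃ (c : PadicAlgCl p) (u : (PowerSeries (padicCoeffIntegers (memberGenerators g ι 𝔇.υ)))ˣ),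
        c ≠ 0 ∧
          L = PowerSeries.C c *
            PowerSeries.map (padicCoeffIntegers (memberGenerators g ι 𝔇.υ)).subtype
              ((u : PowerSeries (padicCoeffIntegers (memberGenerators g ι 𝔇.υ))) * G)

/-- The level-`N/p` instance `thm4_rational_weightK_member_of_bdd` IS the level-generic twin at
`M := N/p` (its own binder `p ∤ N/p` feeds Wan's `p ∤ M`; an `IsOrdinaryMemberOf` member is an
`IsOrdinaryMemberOfLevel` member). Deprecate-and-add bookkeeping: the old fact is implied by
(weaker than) the new one. [cite: Wan2015, Thm. 4 (pp. 4–5) = Thm. 103 (pp. 91–92)] -/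
theorem thm4_rational_weightK_member_of_bdd.of_ofLevel
    (h : thm4_rational_weightK_member_of_bdd_ofLevel) : thm4_rational_weightK_member_of_bdd := by
  intro W _ _ p _ hp hmult hsurj _ hpM k g ι hmem 𝔇 κ γ hκ hγ hγ' D htors G hG Dsym L hL hbdd
  exact h W p hp hmult hsurj hpM g ι (IsOrdinaryMemberOf.ofLevel hmem) 𝔇 κ γ hκ hγ hγ' D htors G hG Dsym L hL hbdd


/-! ### Instance under the PRINTED image hypothesis (irred) (prover seat bsd-line-er5-p2, crux 19064
`X11aLowerHalf`, non-surjective sub-leaf, 2026-08-28; deprecate-and-add — nothing above is changed)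

Wan's Thm. 4 is PRINTED under "(irred) and (dist)" — `ρ̄_f` IRREDUCIBLE. The two instances above bind
`W.HasSurjectiveModNGaloisRep p` because the literature seat discharged the un-printed hypothesis (H1) of
Fujiwara's Thm. 8 (used in the proof of Thm. 103, p. 92; made explicit by Burungale–Castella–Skinner 2025
Hyp. 3.1.1) through surjectivity. The twin below binds the printed `W.HasIrreducibleModPGaloisRep p`
instead (otherwise BYTE-IDENTICAL to `thm4_rational_weightK_member_of_bdd_ofLevel`, which it implies —
a surjective `ρ̄_{E,p}` is irreducible) and records in its docstring why (H1) holds on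
the whole instance (every irreducible `E[p]` at a multiplicative `p ≥ 5`): the argument of BCS 2025
Lemma 5.2.3 uses only irreducibility, `p ≥ 5` and the ordinary inertia shape `(ω ∗; 0 1)`, which a Tate
curve has. Consumer: the x11a chain on the NON-surjective X11a sub-leaf
(`Summits/…/Theorems/PrintX11aLowerHalfNonSurjChain.lean`). -/

/-- **X. Wan, Forum Math. Sigma 3 (2015) e18,
Thm. 4 (pp. 4–5) = Thm. 103 (pp. 91–92), RATIONAL part, bounded (print-faithful) interpolant,
level-generic — instance: an ordinary weight-`k` member `(g, ι)` of the Hida family `H(E[p])` of an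
elliptic curve `E/ℚ` with `p ‖ N`, `p ≥ 5`, and `E[p]` IRREDUCIBLE.** Printed statement (verbatim):
"THEOREM 4. Suppose that `p ≥ 5`. Let `f ∈ S_κ(M, L)`, `2 | κ ≥ 2` be a `p`-ordinary cuspidal eigenform
with trivial character, `p ∤ M`, and `L ⊂ ℚ̄_p` a finite extension of `ℚ_p`. Suppose that • (irred) and
(dist) hold for `ρ_f`. Then, for any set of primes `Σ`, `char^Σ_{ℚ∞,L}(f) = (L^Σ_f)` in
`Λ_{ℚ,𝒪_L} ⊗_{ℤ_p} ℚ_p`." with (p. 3) "(irred) The residual Galois representation `ρ̄_f` of `f` is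
irreducible. (dist) For `V = ρ_f` and each prime `v | p`, the `𝒪_L^×`-valued characters giving the
actions of `G_{F,v}` on `V_v^+` and `V/V_v^+` are distinct modulo the maximal ideal of `𝒪_L`".
Typed EXACTLY as the level-generic instance `thm4_rational_weightK_member_of_bdd_ofLevel` above
(same dictionary: `char_{ℚ∞,L}(f)` = the `Λ_𝒪`-dual of Greenberg's `Sel(ℚ_∞, A_g)`, `GreenbergSelmer.DualData`;
`L_f` = THE bounded cyclotomic `p`-adic `L`-function of `(g, ι, υ)`, `IsCycPAdicLFunctionWeightK` + the
boundedness clause, unique by `IsCycPAdicLFunctionWeightK.eq_of_bounded`; conclusion `L = c · (u · G)`,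
`c ∈ ℚ̄_p^×`, `u ∈ Λ_𝒪^×` — "equality in `Λ_𝒪 ⊗ ℚ_p`"; `Σ = ∅`), with ONE binder changed: the image
hypothesis is the PRINTED one, `W.HasIrreducibleModPGaloisRep p` (`E[p]` irreducible, so
`ρ̄_f ≅ ρ̄_{g,ι} ≅ E[p]` irreducible = (irred)), in place of `W.HasSurjectiveModNGaloisRep p`; hence this
fact IMPLIES the Surj instance (a surjective `ρ̄_{E,p}` is irreducible; bookkeeping theorem `NonSurjChain.thm4_irred_to_ofLevel` in the consumer `Summits/…/Theorems/PrintX11aLowerHalfNonSurjChain.lean`). Discharge of the printed hypotheses on the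
instance: `p ≥ 5` ✓; `2 ∣ κ ≥ 2` ✓ (`k > 2`, `k ≡ 2 (mod p − 1)`); trivial character ✓ (`Γ₀(M)`);
`p ∤ M` ✓ (binder); `p`-ordinary ✓ (`|ι a_p(g)|_p = 1`); (irred) ✓ (binder); (dist) ✓ — at `p ‖ N` the
two characters on inertia at `p` are `ω` and `1` (Tate curve), distinct for `p > 2`.
UN-PRINTED HYPOTHESES (flag `Wan15-Thm103-Fujiwara`, informational, as on the Surj instance; cf.
Burungale–Castella–Skinner, IMRN 2025 = arXiv:2405.00270, Hyp. 3.1.1 (H1)–(H3) p. 7 and Rem. 1.1.3 (ii),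
Rem. 3.2.2: "Wan uses the above divisibility in conjunction with base change to remove the condition
(mult) from the result of [SU14] up to tensoring with `ℚ_p` (cf. [Wan15, Thm. 4])"): Wan's proof of
Thm. 103 (p. 92) base-changes to a real quadratic `F` with `p` unramified, every `ℓ ∣ M` with
`ℓ ≡ −1 (mod p)` inert and every other `ℓ ∣ M` split, and invokes Fujiwara's Thm. 8 for `ρ̄|_{G_F}`:
(H1) `ρ̄|_{G_{F(ζ_p)}}` absolutely irreducible; (H2) a minimal modular lifting ("the base change to `F`
of a minimal modular lifting of `ρ̄_f`", p. 92); (H3) `q_v ≢ −1 (mod p)` at the relevant `v` ("guaranteed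
by our choice of `F`", p. 92; BCS p. 10). On THIS instance (H1) holds for a positive proportion of the
admissible `F` by the argument of BCS Lemma 5.2.3 (p. 10), which uses only that `ρ̄` is irreducible,
`p ≥ 5`, and that `ρ̄|_{I_p} ∼ (ω ∗; 0 1)` — the ordinary inertia shape, IDENTICAL at a multiplicative
`p` (Tate curve): choose `F` outside the (≤ 3) quadratic subfields of `ℚ(E[p])` (so `ρ̄|_{G_F}` is
irreducible) and `F ≠ ℚ(ζ_5)⁺`; if `ρ̄|_{G_{F(ζ_p)}}` were reducible, `ρ̄|_{G_F}` would be induced from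
the quadratic subextension of `F(ζ_p)/F`, ramified at `p`, forcing `ω² = 1` on `I_p`, i.e. `p = 3`.
(Group-theoretically: at `p ‖ N`, `p ≥ 5`, an irreducible non-surjective `ρ̄_{E,p}` has image the FULL
normaliser of a split Cartan — the inertia torus `{diag(a,1)}` and one anti-diagonal element generate
it — or, at `p = 5`, the group `5S4 ⊇ 𝔽_5^×`; in both cases `ρ̄(G_{ℚ(ζ_p)}) = image ∩ SL₂(𝔽_p)`
(`N(C_s) ∩ SL₂`, resp. `2.A₄`) acts absolutely irreducibly; Serre 1972 §2.4–2.6.) ONLY THE RATIONAL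
EQUALITY IS VENDORED (the integral refinement needs `SL₂(ℤ_p) ⊆ im ρ_f` and the `p`-integral period
comparison of BCS Rem. 1.1.3 (ii); not vendored). Named fact; nothing asserted; no `_holds`.
-- TODO(general form): the printed generality — any p-ordinary eigenform of even weight ≥ 2, trivial
-- character, p ∤ M, under (irred) + (dist) alone, any Σ; the INTEGRAL equality not vendored.
[cite: Wan2015, Thm. 4 (pp. 4–5) = Thm. 103 (pp. 91–92) and proof p. 92; Thm. 8 (pp. 6–7)]
[cite: BurungaleCastellaSkinner2025, Hyp. 3.1.1 and Rem. 3.1.2 (arXiv:2405.00270 p. 7), Lemma 5.2.3 (p. 10), Rem. 1.1.3 (ii) (p. 2)]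
[cite: SkinnerUrban2014, §3.1.3 (p. 18) and Thm. 1 (p. 2) = Thm. 3.6.4 (p. 43) (journal numbering: Thm. 3.29)]
[cite: EmertonPollackWeston2006, Intro p. 2 (H(ρ̄): members of every tame level) (arXiv:math/0404484 p. 2)] -/
def thm4_rational_weightK_member_of_bdd_ofLevel_irred : Prop :=
  ∀ (W : WeierstrassCurve ℚ) [W.IsElliptic] [W.IsGloballyMinimal] (p : ℕ) [Fact p.Prime],
    5 ≤ p → W.HasMultiplicativeReductionAtPrime p → W.HasIrreducibleModPGaloisRep p →
    ∀ {M : ℕ} [NeZero M], ¬ p ∣ M →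
    ∀ {k : ℤ} (g : CuspForm (Gamma0 M) k)
      (ι : coeffField g →+* PadicAlgCl p), IsOrdinaryMemberOfLevel W p g ι →
    ∀ (𝔇 : OrdinaryPadicData g p ι) (κ : ZpExtension ℚ p) (γ : Field.absoluteGaloisGroup ℚ),
      κ.IsCyclotomic → κ.IsTopGenerator γ → IsCyclotomicVariable p γ →
    ∀ (D : GreenbergSelmer.DualData (padicCoeffField (memberGenerators g ι 𝔇.υ)) κ γ 𝔇.ρ 𝔇.plus),
      Module.IsTorsion (PowerSeries (padicCoeffIntegers (memberGenerators g ι 𝔇.υ))) D.X →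
    ∀ G : PowerSeries (padicCoeffIntegers (memberGenerators g ι 𝔇.υ)),
      D.charIdeal = Ideal.span {G} →
    ∀ (Dsym : PeriodSymbolDatum g) (L : PowerSeries (PadicAlgCl p)),
      IsCycPAdicLFunctionWeightK g Dsym p ι 𝔇.υ L →
      (∃ C : ℝ, ∀ i, ‖PowerSeries.coeff i L‖ ≤ C) →
      ∃ (c : PadicAlgCl p) (u : (PowerSeries (padicCoeffIntegers (memberGenerators g ι 𝔇.υ)))ˣ),
        c ≠ 0 ∧
          L = PowerSeries.C c *
            PowerSeries.map (padicCoeffIntegers (memberGenerators g ι 𝔇.υ)).subtype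
              ((u : PowerSeries (padicCoeffIntegers (memberGenerators g ι 𝔇.υ))) * G)

end Literature.NumberTheory.EllipticCurves.Wan2015

end
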